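import Literature.AnabelianGeometry.EtaleTheta.SettingModelKummerCocycleQ
import Literature.AnabelianGeometry.AbsoluteAnabelian.ZHatCompletionAdicCompleteness
import HarnessLib

/-!
# The `Ẑ`-valued Kummer cocycle of ANY `G_{ℚ_p}`-fixed unit of `ℚ̄_p` for a chosen root system; the cocycle
# `κ_p` of `q̈ = p`; its powers `κ_p^i` (`κ_{q_X} ∼ κ_p²`); and the pair homomorphism
# `σ ↦ ((κ_p(σ)^i, κ_p(σ)^j), χ(σ)) : G_{ℚ_p} → (Ẑ × Ẑ) ⋊ Ẑ^×`
# (R78 cluster of the abc-iut cell, file F3c-2 = sequel of `SettingModelKummerCocycleQ`; STAGE 2 «Tate shear» with the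
# third («`c`-shear» / inner) parameter of abc-iut-L2-t12's spec 06:59Z and abc-iut-L2-t6's F2c)

S. Mochizuki, *The étale theta function …*, Publ. RIMS **45** (2009) [EtTh], §1 p. 13 ("`K_N := K(ζ_N, q_X^{1/N})`")
and p. 17 ("`K̈ = K(ζ₂, q_X^{1/2})`", the square root `q̈` of the `q`-parameter; in the model `q_X = p²`, `q̈ = p`)
[cite: MochizukiEtTh2009, §1 p.17]; J. Neukirch, *Algebraic Number Theory*, Ch. IV §3 (Kummer theory)
[cite: NeukirchANT1999, Ch. IV §3]; the tree's `RootSystem.kummerCocycle` / `isMulCocycle₁_kummerCocycle` /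
`kummerCocycle_mul` / `kummerCocycle_div_kummerCocycle` (`KummerClass.lean`, [LANA2026Report, §6.1 p.31]).

abc-iut cell, layer L2, seat abc-iut-L2-t5 (gen 5).  WHY A SEQUEL: F3c fixed ONE root system `qRoots p` of
`q = p²`; the STAGE-2 spec of abc-iut-L2-t12 (STATUS 06:59:06Z: "`[k] = 2·κ(q̈) = κ(q_X)` and `[m] = −κ(q̈)`") and
abc-iut-L2-t6's F2c (`affTwist₃ : ((ZH × ZH) ⋊[diagAut] MulAut ZH) →* MulAut F̂₂`, STATUS 07:13:16Z) want the
cocycle of the SQUARE ROOT `q̈ = p` and its powers.  Everything here is ADDITIVE (F3c untouched) and GENERIC: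

* `kummerZH x hu : GQp p → ZH` for ANY unit `u ∈ ℚ̄_pˣ` fixed by `G_{ℚ_p}` (`hu : u ∈ fixedPoints ⊤`) and ANY
  compatible root system `x : RootSystem u` — `:= cycEquiv p ∘ (x.kummerCocycle at H = ⊤)`, i.e. the tree's Kummer
  cocycle read in `Ẑ` through F3c's chosen `e = cycEquiv p`; `kummerZH_mul` (the `χ`-COCYCLE LAW), `kummerZH_one`,
  `apply_root_eq` (`σ(u^{1/N}) = ξ_N^{κ mod N} · u^{1/N}`), `level_kummerZH_eq_one_iff` (level-`N` kernel = stabiliser of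
  the chosen `u^{1/N}`), `isLocallyConstant_level_kummerZH`, `kummerZH_mulRoots` (product of root systems ↦ product
  of cocycles), `kummerZH_eq_mul_coboundary` (changing the root system changes the cocycle by an EXPLICIT coboundary),
  `kappaQ_eq_kummerZH` (F3c's `kappaQ` is the instance `x = qRoots p`);
* `IsChiCocycle p k :≡ ∀ σ τ, k (σ * τ) = k σ * chi p σ (k τ)` is NOT introduced as a definition (no Prop-valued defs in
  this lane): the closure properties are stated as plain implications `chiCocycle_inv`, `chiCocycle_zpow`,
  `chiCocycle_mul`;
* `pUnit p`, **`pRoots p : RootSystem (pUnit p)`** — THE CHOSEN compatible roots `(p^{1/N})_N` of `q̈ = p` —,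
  `pRoot p N`, **`kappaP p : GQp p → ZH`** with `kappaP_mul`, `kappaP_one`, `level_kappaP_eq_one_iff`,
  `isLocallyConstant_level_kappaP`, `apply_pRoot`, `kappaP_zpow_mul` (`κ_p^i` is a `χ`-cocycle for every `i : ℤ`);
* `qRootsOfP p : RootSystem (qUnit p)` — the roots of `q = p²` that are the SQUARES of the chosen roots of `p` — with
  **`kummerZH_qRootsOfP : kummerZH (qRootsOfP p) _ σ = kappaP p σ ^ 2`** ("`κ(q_X) = 2κ(q̈)`") and
  `kappaQ_eq_kappaP_sq_mul_coboundary` (F3c's `kappaQ`, built on the independent choice `qRoots p`, differs from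
  `κ_p²` by the explicit coboundary of `z₀ := e (qRoots / qRootsOfP)`);
* **`cocyclePairHom Φ hΦ i j : GQp p →* (ZH × ZH) ⋊[Φ] MulAut ZH`**, `σ ↦ ⟨((κ_p σ)^i, (κ_p σ)^j), χ σ⟩`, for ANY
  `Φ : MulAut ZH →* MulAut (ZH × ZH)` acting diagonally (`hΦ : ∀ u z, Φ u z = (u z.1, u z.2)` — abc-iut-L2-t6's F2c
  `diagAut` by name) and ANY integer exponents (`(i, j) = (−1, 2)` is L2-t12's `(m, k) = (−κ, 2κ)`; flip both signs for
  the opposite deck orientation); `cocyclePairHom_left/_right`, `rightHom_comp_cocyclePairHom`.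

Choices made here (and ONLY these): the root system `pRoots p`.  A model is consistency evidence only; nothing here
bears on [IUTchIII] Cor. 3.12.
-/

noncomputable section

open CategoryTheory ProfiniteGrp ProfiniteGrp.ProfiniteCompletion groupCohomology

namespace Literature.AnabelianGeometry.EtaleTheta.SettingModel

open Literature.AnabelianGeometry.SemiGraphs (GQp)
open Literature.AnabelianGeometry.AbsoluteAnabelian (ZHatCompletion.mul_comm)

variable (p : ℕ) [Fact p.Prime]

/-! ### Generic: the `Ẑ`-valued Kummer cocycle of a fixed unit for a chosen root system -/

section Generic

variable {p}
variable {u v : (PadicAlgCl p)ˣ} (x : RootSystem u) (y : RootSystem v)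
  (hu : u ∈ MulAction.fixedPoints (⊤ : Subgroup (GQp p)) (PadicAlgCl p)ˣ)
  (hv : v ∈ MulAction.fixedPoints (⊤ : Subgroup (GQp p)) (PadicAlgCl p)ˣ)

/-- A unit fixed by every `σ ∈ G_{ℚ_p}` is a fixed point of the full subgroup `⊤` (the hypothesis shape of the tree's
`RootSystem.kummerCocycle`). [cite: LANA2026Report, §6.1 p.31] -/
theorem mem_fixedPoints_top_of_forall {w : (PadicAlgCl p)ˣ} (h : ∀ σ : GQp p, σ • w = w) :
    w ∈ MulAction.fixedPoints (⊤ : Subgroup (GQp p)) (PadicAlgCl p)ˣ := fun g => h g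

/-- Units of `ℚ_p` are fixed by `G_{ℚ_p}`. [cite: NeukirchANT1999, Ch. IV §1] -/
theorem map_units_mem_fixedPoints_top (a : ℚ_[p]ˣ) :
    Units.map (algebraMap ℚ_[p] (PadicAlgCl p) : ℚ_[p] →* PadicAlgCl p) a ∈
      MulAction.fixedPoints (⊤ : Subgroup (GQp p)) (PadicAlgCl p)ˣ :=
  mem_fixedPoints_top_of_forall fun σ => Units.ext (by
    rw [AlgEquiv.smul_units_def, Units.coe_map, MonoidHom.coe_coe, Units.coe_map, MonoidHom.coe_coe,
      AlgEquiv.commutes])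

/-- **The `Ẑ`-valued Kummer cocycle of the root system `x` of the fixed unit `u`**: `σ ↦ e ((σ(u^{1/N}) / u^{1/N})_N)`,
the tree's `RootSystem.kummerCocycle` (at the full subgroup `H = ⊤ ≤ G_{ℚ_p}`) read in `Ẑ` through F3c's chosen
discrete-logarithm isomorphism `e = cycEquiv p`. [cite: NeukirchANT1999, Ch. IV §3] -/
def kummerZH (σ : GQp p) : ZH :=
  cycEquiv p (x.kummerCocycle (H := (⊤ : Subgroup (GQp p))) hu ⟨σ, Subgroup.mem_top σ⟩)

/-- [cite: NeukirchANT1999, Ch. IV §3] -/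
theorem kummerZH_def (σ : GQp p) :
    kummerZH x hu σ = cycEquiv p (x.kummerCocycle (H := (⊤ : Subgroup (GQp p))) hu ⟨σ, Subgroup.mem_top σ⟩) := rfl

/-- Components of the underlying cyclotome-valued cocycle: `(σ • x_N) / x_N`. [cite: LANA2026Report, §6.1 p.31] -/
theorem kummerCocycle_top_apply (σ : GQp p) (n : ℕ+) :
    ((x.kummerCocycle (H := (⊤ : Subgroup (GQp p))) hu ⟨σ, Subgroup.mem_top σ⟩ : cyclotome (PadicAlgCl p)ˣ) :
      ℕ+ → (PadicAlgCl p)ˣ) n = σ • x.root n / x.root n := rfl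

/-- `κ(1) = 1`. [cite: NeukirchANT1999, Ch. IV §3] -/
theorem kummerZH_one : kummerZH x hu 1 = 1 := by
  rw [kummerZH_def, ← (cycEquiv p).map_one]
  congr 1
  refine Subtype.ext (funext fun n => ?_)
  rw [kummerCocycle_top_apply, one_smul, div_self']
  rfl

/-- **THE `χ`-COCYCLE LAW** `κ(στ) = κ(σ) · χ(σ)(κ(τ))` (from the tree's `isMulCocycle₁_kummerCocycle` and F3c's
equivariance `cycEquiv_smul`). [cite: NeukirchANT1999, Ch. IV §3] -/
theorem kummerZH_mul (σ τ : GQp p) : kummerZH x hu (σ * τ) = kummerZH x hu σ * chi p σ (kummerZH x hu τ) := by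
  have h := x.isMulCocycle₁_kummerCocycle (H := (⊤ : Subgroup (GQp p))) hu ⟨σ, Subgroup.mem_top σ⟩
    ⟨τ, Subgroup.mem_top τ⟩
  rw [kummerZH_def, kummerZH_def, kummerZH_def, ← cycEquiv_smul, ← map_mul, mul_comm]
  congr 1

/-- **The defining formula** `σ(u^{1/N}) = ξ_N ^ (κ(σ) mod N) · u^{1/N}`. [cite: NeukirchANT1999, Ch. IV §3] -/
theorem apply_root_eq (σ : GQp p) (N : ℕ+) :
    σ ((x.root N : (PadicAlgCl p)ˣ) : PadicAlgCl p) =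
      (((cycGen p : ℕ+ → (PadicAlgCl p)ˣ) N : (PadicAlgCl p)ˣ) : PadicAlgCl p) ^
        (Multiplicative.toAdd (ZHatLevel.level N (kummerZH x hu σ))).val * ((x.root N : (PadicAlgCl p)ˣ) : PadicAlgCl p) := by
  have h := congrArg (fun w : (PadicAlgCl p)ˣ => (w : PadicAlgCl p))
    (cycGen_pow_level p (x.kummerCocycle (H := (⊤ : Subgroup (GQp p))) hu ⟨σ, Subgroup.mem_top σ⟩) N)
  simp only [Units.val_pow_eq_pow_val] at h
  rw [kummerCocycle_top_apply, Units.val_div_eq_div_val, AlgEquiv.smul_units_def, Units.coe_map,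
    MonoidHom.coe_coe] at h
  rw [kummerZH_def, h, div_mul_cancel₀ _ (x.root N).ne_zero]

/-- **The level-`N` kernel**: `κ(σ) ≡ 0 (mod N)` iff `σ` fixes the chosen root `u^{1/N}` (as units).
[cite: NeukirchANT1999, Ch. IV §3] -/
theorem level_kummerZH_eq_one_iff_smul (σ : GQp p) (N : ℕ+) :
    ZHatLevel.level N (kummerZH x hu σ) = 1 ↔ σ • x.root N = x.root N := by
  rw [kummerZH_def, level_cycEquiv_eq_one_iff, kummerCocycle_top_apply, div_eq_one]

/-- … and in the field: `level N (κ σ) = 1 ↔ σ (u^{1/N}) = u^{1/N}`. [cite: NeukirchANT1999, Ch. IV §3] -/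
theorem level_kummerZH_eq_one_iff (σ : GQp p) (N : ℕ+) :
    ZHatLevel.level N (kummerZH x hu σ) = 1 ↔
      σ ((x.root N : (PadicAlgCl p)ˣ) : PadicAlgCl p) = ((x.root N : (PadicAlgCl p)ˣ) : PadicAlgCl p) := by
  rw [level_kummerZH_eq_one_iff_smul, Units.ext_iff, AlgEquiv.smul_units_def, Units.coe_map, MonoidHom.coe_coe]

/-- **LOCAL CONSTANCY of `σ ↦ κ(σ) mod N`** (Krull topology): a function of `σ • u^{1/N}`, which is locally constant
(abc-iut-L2-t11's `isLocallyConstant_smul_units_of_isAlgebraic`). [cite: NeukirchANT1999, Ch. IV §1] -/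
theorem isLocallyConstant_level_kummerZH (N : ℕ+) :
    IsLocallyConstant fun σ : GQp p => ZHatLevel.level N (kummerZH x hu σ) := by
  classical
  haveI : NeZero (N : ℕ) := ⟨N.ne_zero⟩
  set r : (PadicAlgCl p)ˣ := x.root N with hr
  set ξ : (PadicAlgCl p)ˣ := (cycGen p : ℕ+ → (PadicAlgCl p)ˣ) N with hξ
  let g : (PadicAlgCl p)ˣ → Multiplicative (ZMod N) := fun w =>
    if h : ∃ c : ZMod N, ξ ^ c.val = w / r then Multiplicative.ofAdd h.choose else 1
  have hfun : (fun σ : GQp p => ZHatLevel.level N (kummerZH x hu σ)) = g ∘ fun σ : GQp p => σ • r := by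
    funext σ
    have hex : ∃ c : ZMod N, ξ ^ c.val = σ • r / r :=
      ⟨Multiplicative.toAdd (ZHatLevel.level N (kummerZH x hu σ)), by
        rw [hξ, hr, ← kummerCocycle_top_apply x hu, kummerZH_def, cycGen_pow_level]⟩
    have hg : g (σ • r) = Multiplicative.ofAdd hex.choose := by
      simp only [g, dif_pos hex]
    rw [Function.comp_apply, hg, kummerZH_def, level_cycEquiv_eq_iff, kummerCocycle_top_apply, ← hr, ← hξ]
    exact hex.choose_spec
  rw [hfun]
  exact (isLocallyConstant_smul_units_of_isAlgebraic r).comp g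

/-- The fibres `{σ | κ(σ) ≡ c (N)}` are open. [cite: NeukirchANT1999, Ch. IV §1] -/
theorem isOpen_setOf_level_kummerZH_eq (N : ℕ+) (c : Multiplicative (ZMod N)) :
    IsOpen {σ : GQp p | ZHatLevel.level N (kummerZH x hu σ) = c} :=
  (isLocallyConstant_level_kummerZH x hu N).isOpen_fiber c

/-- **Products**: the cocycle of the product root system `x · y` (roots of `u v`) is the product of the cocycles.
[cite: LANA2026Report, §6.1 p.31] -/
theorem kummerZH_mulRoots (huv : u * v ∈ MulAction.fixedPoints (⊤ : Subgroup (GQp p)) (PadicAlgCl p)ˣ) (σ : GQp p) :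
    kummerZH (x.mul y) huv σ = kummerZH x hu σ * kummerZH y hv σ := by
  rw [kummerZH_def, kummerZH_def, kummerZH_def, ← map_mul, RootSystem.kummerCocycle_mul x y hu hv huv]

/-- Transport along an equality of the element does not change the cocycle. [cite: LANA2026Report, §6.1 p.31] -/
theorem kummerZH_cast (h : u = v) (hv' : v ∈ MulAction.fixedPoints (⊤ : Subgroup (GQp p)) (PadicAlgCl p)ˣ) (σ : GQp p) :
    kummerZH (x.cast h) hv' σ = kummerZH x hu σ := by
  subst h
  rfl

/-- **Change of root system = explicit coboundary**: for two root systems `x, x'` of the same `u`, with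
`z₀ := e (x'/x) ∈ Ẑ`, `κ_{x'}(σ) = κ_x(σ) · (χ(σ) z₀ / z₀)`. [cite: LANA2026Report, §6.1 p.31] -/
theorem kummerZH_eq_mul_coboundary (x' : RootSystem u) (σ : GQp p) :
    kummerZH x' hu σ = kummerZH x hu σ *
      (chi p σ (cycEquiv p (RootSystem.divCyclotome x x')) / cycEquiv p (RootSystem.divCyclotome x x')) := by
  have h := RootSystem.kummerCocycle_div_kummerCocycle x' x hu (H := (⊤ : Subgroup (GQp p))) ⟨σ, Subgroup.mem_top σ⟩
  rw [div_eq_iff_eq_mul'] at h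
  have hs : ((⟨σ, Subgroup.mem_top σ⟩ : (⊤ : Subgroup (GQp p))) • RootSystem.divCyclotome x x') =
      σ • RootSystem.divCyclotome x x' := rfl
  rw [kummerZH_def, kummerZH_def, h, map_mul, map_div, hs, cycEquiv_smul]

/-- F3c's `kappaQ` is the instance `x = qRoots p` of `kummerZH`. [cite: NeukirchANT1999, Ch. IV §3] -/
theorem kappaQ_eq_kummerZH (σ : GQp p) :
    kappaQ p σ = kummerZH (qRoots p) (mem_fixedPoints_top_of_forall (smul_qUnit p)) σ := by
  rw [kappaQ_def, kummerZH_def, kappaCyc_eq_kummerCocycle]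

/-! ### `χ`-cocycles are closed under inverses, powers and products (`Ẑ` commutative, `χ(σ)` a group automorphism) -/

/-- If `k` is a `χ`-cocycle then so is `σ ↦ (k σ)⁻¹`. [cite: NeukirchANT1999, Ch. IV §3] -/
theorem chiCocycle_inv {k : GQp p → ZH} (hk : ∀ σ τ, k (σ * τ) = k σ * chi p σ (k τ)) (σ τ : GQp p) :
    (k (σ * τ))⁻¹ = (k σ)⁻¹ * chi p σ (k τ)⁻¹ := by
  rw [hk, mul_inv_rev, map_inv, ZHatCompletion.mul_comm]

/-- If `k` is a `χ`-cocycle then so is `σ ↦ (k σ)^i` for every `i : ℤ`. [cite: NeukirchANT1999, Ch. IV §3] -/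
theorem chiCocycle_zpow {k : GQp p → ZH} (hk : ∀ σ τ, k (σ * τ) = k σ * chi p σ (k τ)) (i : ℤ) (σ τ : GQp p) :
    k (σ * τ) ^ i = k σ ^ i * chi p σ (k τ ^ i) := by
  have hc : Commute (k σ) (chi p σ (k τ)) := ZHatCompletion.mul_comm _ _
  rw [hk, hc.mul_zpow, map_zpow]

/-- The product of two `χ`-cocycles is a `χ`-cocycle. [cite: NeukirchANT1999, Ch. IV §3] -/
theorem chiCocycle_mul {k m : GQp p → ZH} (hk : ∀ σ τ, k (σ * τ) = k σ * chi p σ (k τ))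
    (hm : ∀ σ τ, m (σ * τ) = m σ * chi p σ (m τ)) (σ τ : GQp p) :
    k (σ * τ) * m (σ * τ) = k σ * m σ * chi p σ (k τ * m τ) := by
  rw [hk, hm, map_mul, mul_assoc, mul_assoc, ← mul_assoc (chi p σ (k τ)), ZHatCompletion.mul_comm (chi p σ (k τ)) (m σ),
    mul_assoc]

/-- A `χ`-cocycle takes the value `1` at `1`. [cite: NeukirchANT1999, Ch. IV §3] -/
theorem chiCocycle_one {k : GQp p → ZH} (hk : ∀ σ τ, k (σ * τ) = k σ * chi p σ (k τ)) : k 1 = 1 := by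
  have h := hk 1 1
  rw [mul_one, map_one, MulAut.one_apply] at h
  exact left_eq_mul.mp h

end Generic

/-! ### The cocycle `κ_p` of `q̈ = p` for the chosen roots `p^{1/N}` -/

/-- `q̈ = p` as a unit of `ℚ̄_p`, the image of the unit `p ∈ ℚ_pˣ` ("`K̈ = K(ζ₂, q_X^{1/2})`", `q_X = p²`).
[cite: MochizukiEtTh2009, §1 p.17] -/
def pUnit : (PadicAlgCl p)ˣ :=
  Units.map (algebraMap ℚ_[p] (PadicAlgCl p) : ℚ_[p] →* PadicAlgCl p)
    (Units.mk0 ((p : ℕ) : ℚ_[p]) (Nat.cast_ne_zero.mpr (Fact.out : p.Prime).ne_zero))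

/-- [cite: MochizukiEtTh2009, §1 p.17] -/
@[simp] theorem coe_pUnit : ((pUnit p : (PadicAlgCl p)ˣ) : PadicAlgCl p) = (p : PadicAlgCl p) := by
  rw [pUnit, Units.coe_map, MonoidHom.coe_coe, Units.val_mk0, map_natCast]

/-- `q̈ = p` is fixed by `G_{ℚ_p}`. [cite: MochizukiEtTh2009, §1 p.17] -/
theorem pUnit_mem_fixedPoints : pUnit p ∈ MulAction.fixedPoints (⊤ : Subgroup (GQp p)) (PadicAlgCl p)ˣ :=
  map_units_mem_fixedPoints_top _

/-- `q̈² = q`: `pUnit p * pUnit p = qUnit p`. [cite: MochizukiEtTh2009, §1 p.17] -/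
theorem pUnit_mul_pUnit : pUnit p * pUnit p = qUnit p :=
  Units.ext (by rw [Units.val_mul, coe_pUnit, coe_qUnit, qModel, sq])

/-- **THE CHOSEN compatible system of roots `(p^{1/N})_{N ≥ 1}` of `q̈ = p`** (`RootSystem.ofRootableBy`, `ℚ̄_p`
algebraically closed). [cite: MochizukiEtTh2009, §1 p.17] -/
def pRoots : RootSystem (pUnit p) := RootSystem.ofRootableBy (pUnit p)

/-- The chosen `N`-th root `p^{1/N} ∈ ℚ̄_p`. [cite: MochizukiEtTh2009, §1 p.17] -/
def pRoot (N : ℕ+) : PadicAlgCl p := (((pRoots p).root N : (PadicAlgCl p)ˣ) : PadicAlgCl p)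

/-- [cite: MochizukiEtTh2009, §1 p.17] -/
theorem coe_pRoots_root (N : ℕ+) : (((pRoots p).root N : (PadicAlgCl p)ˣ) : PadicAlgCl p) = pRoot p N := rfl

/-- `(p^{1/N})^N = p`. [cite: MochizukiEtTh2009, §1 p.17] -/
theorem pRoot_pow (N : ℕ+) : pRoot p N ^ (N : ℕ) = (p : PadicAlgCl p) := by
  have h := congrArg (fun w : (PadicAlgCl p)ˣ => (w : PadicAlgCl p)) ((pRoots p).pow_self N)
  simp only [Units.val_pow_eq_pow_val, coe_pUnit] at h
  exact h

/-- Compatibility: `(p^{1/NM})^M = p^{1/N}`. [cite: MochizukiEtTh2009, §1 p.17] -/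
theorem pRoot_mul_pow (N M : ℕ+) : pRoot p (N * M) ^ (M : ℕ) = pRoot p N := by
  have h := congrArg (fun w : (PadicAlgCl p)ˣ => (w : PadicAlgCl p)) ((pRoots p).root_mul_pow N M)
  simp only [Units.val_pow_eq_pow_val] at h
  exact h

/-- `p^{1/N} ≠ 0`. [cite: MochizukiEtTh2009, §1 p.17] -/
theorem pRoot_ne_zero (N : ℕ+) : pRoot p N ≠ 0 := ((pRoots p).root N).ne_zero

/-- **The Kummer cocycle `κ_p : G_{ℚ_p} → Ẑ` of `q̈ = p`** for the chosen roots `pRoots p` (L2-t12's `κ := κ(q̈) = κ_p`).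
[cite: NeukirchANT1999, Ch. IV §3] -/
def kappaP (σ : GQp p) : ZH := kummerZH (pRoots p) (pUnit_mem_fixedPoints p) σ

/-- [cite: NeukirchANT1999, Ch. IV §3] -/
theorem kappaP_def (σ : GQp p) : kappaP p σ = kummerZH (pRoots p) (pUnit_mem_fixedPoints p) σ := rfl

/-- `κ_p(1) = 1`. [cite: NeukirchANT1999, Ch. IV §3] -/
theorem kappaP_one : kappaP p 1 = 1 := kummerZH_one _ _

/-- **THE COCYCLE LAW** `κ_p(στ) = κ_p(σ) · χ(σ)(κ_p(τ))`. [cite: NeukirchANT1999, Ch. IV §3] -/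
theorem kappaP_mul (σ τ : GQp p) : kappaP p (σ * τ) = kappaP p σ * chi p σ (kappaP p τ) := kummerZH_mul _ _ σ τ

/-- `κ_p^i` is a `χ`-cocycle for every `i : ℤ` (`i = 2`: the class of `q_X = p²`; `i = −1`: L2-t12's `[m] = −κ(q̈)`).
[cite: NeukirchANT1999, Ch. IV §3] -/
theorem kappaP_zpow_mul (i : ℤ) (σ τ : GQp p) :
    kappaP p (σ * τ) ^ i = kappaP p σ ^ i * chi p σ (kappaP p τ ^ i) :=
  chiCocycle_zpow (kappaP_mul p) i σ τ

/-- `σ(p^{1/N}) = ξ_N ^ (κ_p(σ) mod N) · p^{1/N}`. [cite: NeukirchANT1999, Ch. IV §3] -/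
theorem apply_pRoot (σ : GQp p) (N : ℕ+) :
    σ (pRoot p N) = (((cycGen p : ℕ+ → (PadicAlgCl p)ˣ) N : (PadicAlgCl p)ˣ) : PadicAlgCl p) ^
        (Multiplicative.toAdd (ZHatLevel.level N (kappaP p σ))).val * pRoot p N :=
  apply_root_eq _ _ σ N

/-- **Level-`N` kernel of `κ_p`** = stabiliser of the chosen `p^{1/N}`. [cite: NeukirchANT1999, Ch. IV §3] -/
theorem level_kappaP_eq_one_iff (σ : GQp p) (N : ℕ+) :
    ZHatLevel.level N (kappaP p σ) = 1 ↔ σ (pRoot p N) = pRoot p N :=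
  level_kummerZH_eq_one_iff _ _ σ N

/-- **Local constancy of `σ ↦ κ_p(σ) mod N`.** [cite: NeukirchANT1999, Ch. IV §1] -/
theorem isLocallyConstant_level_kappaP (N : ℕ+) :
    IsLocallyConstant fun σ : GQp p => ZHatLevel.level N (kappaP p σ) :=
  isLocallyConstant_level_kummerZH _ _ N

/-- The fibres `{σ | κ_p(σ) ≡ c (N)}` are open in `G_{ℚ_p}`. [cite: NeukirchANT1999, Ch. IV §1] -/
theorem isOpen_setOf_level_kappaP_eq (N : ℕ+) (c : Multiplicative (ZMod N)) :
    IsOpen {σ : GQp p | ZHatLevel.level N (kappaP p σ) = c} :=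
  isOpen_setOf_level_kummerZH_eq _ _ N c

/-! ### `κ(q_X) ∼ κ_p²`: the square root system of `q = p²` -/

/-- The root system of `q = p²` consisting of the SQUARES of the chosen roots of `q̈ = p`:
`q^{1/N} := (p^{1/N})²`. [cite: MochizukiEtTh2009, §1 p.17] -/
def qRootsOfP : RootSystem (qUnit p) := ((pRoots p).mul (pRoots p)).cast (pUnit_mul_pUnit p)

/-- Roots of `qRootsOfP`: `(p^{1/N})²`. [cite: MochizukiEtTh2009, §1 p.17] -/
theorem qRootsOfP_root (N : ℕ+) : (qRootsOfP p).root N = (pRoots p).root N * (pRoots p).root N := rfl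

/-- **`κ(q_X) = 2 κ(q̈)`** for the square root system: `kummerZH (qRootsOfP p) σ = κ_p(σ)²`.
[cite: MochizukiEtTh2009, §1 p.17] -/
theorem kummerZH_qRootsOfP (σ : GQp p) :
    kummerZH (qRootsOfP p) (mem_fixedPoints_top_of_forall (smul_qUnit p)) σ = kappaP p σ ^ 2 := by
  have huu : pUnit p * pUnit p ∈ MulAction.fixedPoints (⊤ : Subgroup (GQp p)) (PadicAlgCl p)ˣ := by
    rw [pUnit_mul_pUnit]
    exact mem_fixedPoints_top_of_forall (smul_qUnit p)
  rw [qRootsOfP, kummerZH_cast ((pRoots p).mul (pRoots p)) huu (pUnit_mul_pUnit p) _ σ,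
    kummerZH_mulRoots (pRoots p) (pRoots p) (pUnit_mem_fixedPoints p) (pUnit_mem_fixedPoints p) huu σ, sq,
    kappaP_def]

/-- **F3c's `kappaQ` versus `κ_p²`**: the two root systems `qRoots p` (chosen in F3c) and `qRootsOfP p` of `q = p²`
differ by the cyclotome element `ζ₀ := qRoots / qRootsOfP`, so with `z₀ := e ζ₀ ∈ Ẑ`,
`κ_q(σ) = κ_p(σ)² · (χ(σ) z₀ / z₀)` — SAME CLASS, explicit coboundary. [cite: LANA2026Report, §6.1 p.31] -/
theorem kappaQ_eq_kappaP_sq_mul_coboundary (σ : GQp p) :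
    kappaQ p σ = kappaP p σ ^ 2 *
      (chi p σ (cycEquiv p (RootSystem.divCyclotome (qRootsOfP p) (qRoots p))) /
        cycEquiv p (RootSystem.divCyclotome (qRootsOfP p) (qRoots p))) := by
  rw [kappaQ_eq_kummerZH, kummerZH_eq_mul_coboundary (qRootsOfP p) (mem_fixedPoints_top_of_forall (smul_qUnit p))
    (qRoots p), kummerZH_qRootsOfP]

/-! ### The pair homomorphism `σ ↦ ((κ_p(σ)^i, κ_p(σ)^j), χ(σ)) : G_{ℚ_p} → (Ẑ × Ẑ) ⋊ Aut(Ẑ)` -/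

section Pair

variable (Φ : MulAut ZH →* MulAut (ZH × ZH)) (hΦ : ∀ (w : MulAut ZH) (z : ZH × ZH), Φ w z = (w z.1, w z.2))

/-- **The pair homomorphism** `σ ↦ ⟨((κ_p σ)^i, (κ_p σ)^j), χ σ⟩ : G_{ℚ_p} →* (Ẑ × Ẑ) ⋊[Φ] Aut(Ẑ)` for the DIAGONAL
action `Φ` of `Aut(Ẑ)` on `Ẑ × Ẑ` (`hΦ`; abc-iut-L2-t6's F2c `diagAut`) and any integer exponents `i, j` — a homomorphism
because both coordinates are `χ`-cocycles (`kappaP_zpow_mul`).  With `(i, j) = (−1, 2)` this is abc-iut-L2-t12's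
`σ ↦ ((m, k), χ) = ((−κ(q̈), 2κ(q̈)), χ)` feeding F2c's `affTwist₃ ⟨(m, k), α⟩ = innB m ∘ shear k ∘ twist α`.
[cite: MochizukiEtTh2009, §1 p.17] -/
def cocyclePairHom (i j : ℤ) : GQp p →* (ZH × ZH) ⋊[Φ] MulAut ZH where
  toFun σ := ⟨(kappaP p σ ^ i, kappaP p σ ^ j), chi p σ⟩
  map_one' := by
    refine SemidirectProduct.ext ?_ ?_
    · show (kappaP p 1 ^ i, kappaP p 1 ^ j) = (1 : (ZH × ZH) ⋊[Φ] MulAut ZH).left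
      rw [SemidirectProduct.one_left, kappaP_one, one_zpow, one_zpow]
      rfl
    · show chi p 1 = (1 : (ZH × ZH) ⋊[Φ] MulAut ZH).right
      rw [SemidirectProduct.one_right, map_one]
  map_mul' σ τ := by
    refine SemidirectProduct.ext ?_ ?_
    · show (kappaP p (σ * τ) ^ i, kappaP p (σ * τ) ^ j) =
        (kappaP p σ ^ i, kappaP p σ ^ j) * Φ (chi p σ) (kappaP p τ ^ i, kappaP p τ ^ j)
      rw [hΦ, Prod.mk_mul_mk, kappaP_zpow_mul, kappaP_zpow_mul]
    · show chi p (σ * τ) = chi p σ * chi p τ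
      rw [map_mul]

/-- `(cocyclePairHom σ).left = ((κ_p σ)^i, (κ_p σ)^j)`. [cite: MochizukiEtTh2009, §1 p.17] -/
@[simp] theorem cocyclePairHom_left (i j : ℤ) (σ : GQp p) :
    (cocyclePairHom p Φ hΦ i j σ).left = (kappaP p σ ^ i, kappaP p σ ^ j) := rfl

/-- `(cocyclePairHom σ).right = χ σ`. [cite: MochizukiEtTh2009, §1 p.17] -/
@[simp] theorem cocyclePairHom_right (i j : ℤ) (σ : GQp p) : (cocyclePairHom p Φ hΦ i j σ).right = chi p σ := rfl

/-- The projection to `Aut(Ẑ)` recovers `χ`. [cite: MochizukiEtTh2009, §1 p.17] -/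
theorem rightHom_comp_cocyclePairHom (i j : ℤ) :
    SemidirectProduct.rightHom.comp (cocyclePairHom p Φ hΦ i j) = chi p := MonoidHom.ext fun _ => rfl

/-- Level-`N` triviality of both coordinates on the stabiliser of `p^{1/N}`: if `σ` fixes `p^{1/N}` then
`level N ((κ_p σ)^i) = 1` for every `i : ℤ` (the `hloc`-input shape of the stage-2 twisted products).
[cite: NeukirchANT1999, Ch. IV §3] -/
theorem level_kappaP_zpow_eq_one {σ : GQp p} {N : ℕ+} (h : σ (pRoot p N) = pRoot p N) (i : ℤ) :
    ZHatLevel.level N (kappaP p σ ^ i) = 1 := by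
  rw [map_zpow, (level_kappaP_eq_one_iff p σ N).mpr h, one_zpow]

/-- The joint stabiliser `{σ | σ ξ_N = ξ_N ∧ σ p^{1/N} = p^{1/N}}` (= `G_{ℚ_p(μ_N, p^{1/N})}`) is open in `G_{ℚ_p}` and on
it `χ_N = 1` and both pair coordinates are level-`N`-trivial. [cite: NeukirchANT1999, Ch. IV §1] -/
theorem isOpen_setOf_levelChar_eq_one_and_level_kappaP_eq_one (N : ℕ+) :
    IsOpen {σ : GQp p | ZHatLevel.levelChar N (chi p σ) = 1 ∧ ZHatLevel.level N (kappaP p σ) = 1} :=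
  (isOpen_setOf_levelChar_chi_eq_one p N).inter (isOpen_setOf_level_kappaP_eq p N 1)

end Pair

end Literature.AnabelianGeometry.EtaleTheta.SettingModel

end
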